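import Literature.Probability.RandomPlanarGeometry.HexSAWBridgeDecay
import HarnessLib

/-!
# Crux `HexConjecture` (stmt-CriticalPhenomena-0808), line `root-locality-replaces-loewner`
(lead c11): unit-step lower regularity of the Glazman–Manolescu triangle tail,
`(2 - √2) · triDl L ≤ triDl (L+1)`

Landing target:
`Summits/CriticalPhenomena/SAWScalingLimit/Theorems/SAWDevelopingMapHexConjectureTriDlStep.lean`
(`--supports stmt-CriticalPhenomena-0808`; registered stub `stub_triDlStep`).

`HV.triDl L = Σ_{P ∈ leftWalks L} x_c^{ℓ(P)}` (`HV.triDl_eq`) is the `x_c`-mass of the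
self-avoiding mid-edge walks of the lattice triangle `T_L = HV.triV L` from the root mid-edge `a`
whose final half-edge crosses the LEFT side of `T_L`, `(-L, K, false) → (-L-1, K, true)`
(Glazman–Manolescu, §4.1, `Σ_K Δ^Δ_{L,K}`).  Such a walk `P = w :: (l ++ [u])`,
`u = (-L-1, K, true)` (`HV.mem_leftWalks`), extends inside the fresh column `x₀ = -L-1` of
`T_{L+1}` (never met by `T_L`, so self-avoidance is automatic) by either of the two 2-step paths
`u → u' = (-L-1, K', false) → u'' = (-L-2, K', true)`, `K' ∈ {K, K+1}`,
each ending with a left half-edge `(u', u'')` of `T_{L+1}`.  The map (walk, choice) ↦ extension is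
injective (drop the last two entries; `u'` records the choice) and multiplies the weight by
`x_c²`; summing, `2 x_c² · triDl L ≤ triDl (L+1)`, and `2 x_c² = 2/(2+√2) = 2 - √2`.
Sources: GlazmanManolescu2019 (§4.1, `T_L`, `Δ^Δ_{L,K}`), DuminilCopinSmirnov2012 (§1, `x_c`).
-/

noncomputable section

open scoped BigOperators Classical
open Finset
open Literature.Probability.RandomPlanarGeometry
open Literature.Probability.RandomPlanarGeometry.SAW
open Literature.Probability.RandomPlanarGeometry.SAW.HV

namespace Summit.CriticalPhenomena.SAWScalingLimit.Theorems.HexConjecture.RootLocality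

/-- `2 x_c² = 2 - √2` (`x_c = 1/√(2+√2)`, so `x_c² = 1/(2+√2) = (2-√2)/2`).
[cite: DuminilCopinSmirnov2012, §1 (x_c)] -/
theorem triDlStep_two_mul_hexCriticalFugacity_sq :
    2 * hexCriticalFugacity ^ 2 = 2 - Real.sqrt 2 := by
  have h := hexCriticalFugacity_sq
  have s : Real.sqrt 2 * Real.sqrt 2 = 2 := Real.mul_self_sqrt (by norm_num)
  linear_combination (2 - Real.sqrt 2) * h + hexCriticalFugacity ^ 2 * s

/-- **The extension of a left-exiting walk of `T_L` is a left-exiting walk of `T_{L+1}`**, for an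
abstract inner list `l` and exit height `K ≤ 2L`: the chain extends by `u ∼ u' ∼ u''`, the new
inner vertices `u`, `u'` lie in the column `x₀ = -L-1` of `T_{L+1}` not met by `l ⊆ T_L`, the
final half-edge `(u', u'')` does not retrace and crosses the left side of `T_{L+1}`.
[cite: GlazmanManolescu2019, §4.1 (T_L)] -/
theorem triDlStep_ext_mem_leftWalks {L K : ℕ} {l : List HV} (hl : l ≠ []) (hK : K ≤ 2 * L)
    {b : ℤ} (hb : 0 ≤ b ∧ b ≤ 1)
    (hW : IsMidWalk (triV L) (wOut :: (l ++ [(-(L : ℤ) - 1, (K : ℤ), true)]))) :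
    wOut :: ((l ++ [(-(L : ℤ) - 1, (K : ℤ), true), (-(L : ℤ) - 1, (K : ℤ) + b, false)]) ++
        [(-(L : ℤ) - 2, (K : ℤ) + b, true)]) ∈ leftWalks (L + 1) := by
  obtain ⟨hchain, hhead, hadj, hV, hnodup, -⟩ := (isMidWalk_cons_append_iff _ hl _).1 hW
  have hl2 :
      l ++ [((-(L : ℤ) - 1, (K : ℤ), true) : HV), (-(L : ℤ) - 1, (K : ℤ) + b, false)] ≠ [] := by
    simp
  have hlast2 :
      (l ++ [((-(L : ℤ) - 1, (K : ℤ), true) : HV), (-(L : ℤ) - 1, (K : ℤ) + b, false)]).getLast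
        hl2 = (-(L : ℤ) - 1, (K : ℤ) + b, false) := by
    simp
  -- every vertex of `l` lies in `T_L`, hence in the columns `x₀ ≥ -L`
  have hxl : ∀ x ∈ l, -(L : ℤ) ≤ x.1 := fun x hx => (mem_triV_iff.1 (hV x hx)).2.1
  rw [leftWalks, Finset.mem_filter, mem_midWalks_iff]
  refine ⟨(isMidWalk_cons_append_iff _ hl2 _).2 ⟨?_, ?_, ?_, ?_, ?_, ?_⟩, ?_⟩
  · -- the chain `l, u, u'`
    rw [List.isChain_append]
    refine ⟨hchain, ?_, ?_⟩
    · rw [List.isChain_pair, hvGraph_adj, AdjRel]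
      right
      refine ⟨rfl, rfl, ?_⟩
      dsimp only
      omega
    · intro x hx y hy
      rw [List.getLast?_eq_some_getLast hl, Option.mem_def, Option.some_inj] at hx
      simp only [List.head?_cons, Option.mem_def, Option.some_inj] at hy
      subst hx; subst hy; exact hadj
  · rw [List.head?_append_of_ne_nil _ hl]; exact hhead
  · rw [hlast2, hvGraph_adj, AdjRel]
    left
    refine ⟨rfl, rfl, Or.inr (Or.inl ⟨?_, rfl⟩)⟩
    show -(L : ℤ) - 2 = -(L : ℤ) - 1 - 1
    ring
  · -- all inner vertices lie in `T_{L+1}`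
    intro x hx
    rw [List.mem_append] at hx
    rcases hx with hx | hx
    · exact triV_mono (Nat.le_succ L) (hV x hx)
    · simp only [List.mem_cons, List.not_mem_nil, or_false] at hx
      rcases hx with rfl | rfl
      · rw [mem_triV_iff]; simp only [bit_true]; push_cast; omega
      · rw [mem_triV_iff]; simp only [bit_false]; push_cast; omega
  · -- no repeated vertex: `u`, `u'` sit in the fresh column `x₀ = -L-1`
    rw [List.nodup_append]
    refine ⟨hnodup, ?_, ?_⟩
    · simp
    · intro x hx y hy hxy
      have h1 := hxl x hx
      simp only [List.mem_cons, List.not_mem_nil, or_false] at hy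
      rcases hy with rfl | rfl
      · rw [hxy] at h1; dsimp only at h1; omega
      · rw [hxy] at h1; dsimp only at h1; omega
  · -- the final half-edge does not retrace: the vertex before `u'` is `u ≠ u''`
    have hprev : prevOf (l ++ [((-(L : ℤ) - 1, (K : ℤ), true) : HV),
        (-(L : ℤ) - 1, (K : ℤ) + b, false)]) = (-(L : ℤ) - 1, (K : ℤ), true) := by
      unfold prevOf
      simp
    rw [hprev]
    intro h
    have := congrArg Prod.fst h
    dsimp only at this
    omega
  · -- the final half-edge `(u', u'')` crosses the left side of `T_{L+1}`
    rw [finalDart_cons_append hl2, hlast2]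
    refine ⟨?_, rfl, ?_⟩
    · show -(L : ℤ) - 1 = -((L + 1 : ℕ) : ℤ)
      push_cast; ring
    · show ((-(L : ℤ) - 2, (K : ℤ) + b, true) : HV) = (-(L : ℤ) - 1 - 1, (K : ℤ) + b, true)
      refine Prod.ext ?_ rfl
      show -(L : ℤ) - 2 = -(L : ℤ) - 1 - 1
      ring

/-- **The two-step extension into the fresh column is injective**: the map
`(P, c) ↦ P ++ [u', u'']`, `u' = (-L-1, K', false)`, `u'' = (-L-2, K', true)`, `K' = exitHt P + c`,
is injective — dropping the last two entries recovers the walk `P`, and `u'` records the choice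
`c`. [folklore] -/
theorem triDlStep_ext_injective (L : ℕ) :
    Function.Injective fun q : List HV × Bool => q.1 ++
      [((-(L : ℤ) - 1, (exitHt q.1 : ℤ) + (if q.2 then 1 else 0), false) : HV),
        (-(L : ℤ) - 2, (exitHt q.1 : ℤ) + (if q.2 then 1 else 0), true)] := by
  rintro ⟨P, c⟩ ⟨P', c'⟩ h
  dsimp only at h
  obtain ⟨hPP, h2⟩ := List.append_inj' h rfl
  subst hPP
  have h3 : ((if c then 1 else 0 : ℤ)) = (if c' then 1 else 0) := by
    have e := congrArg (fun v : HV => v.2.1) (List.cons.inj h2).1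
    simpa using e
  cases c <;> cases c' <;> simp at h3 ⊢

/-- The two-step extension (either choice `c`) of a walk `P ∈ leftWalks L`, which ends at
`u = (-L-1, exitHt P, true)` (`HV.mem_leftWalks`), lies in `leftWalks (L+1)`.
[cite: GlazmanManolescu2019, §4.1 (T_L)] -/
theorem triDlStep_ext_mem {L : ℕ} {P : List HV} (c : Bool) (hP : P ∈ leftWalks L) :
    P ++ [((-(L : ℤ) - 1, (exitHt P : ℤ) + (if c then 1 else 0), false) : HV),
      (-(L : ℤ) - 2, (exitHt P : ℤ) + (if c then 1 else 0), true)] ∈ leftWalks (L + 1) := by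
  obtain ⟨l, hl, hPeq, -, hW, hKle⟩ := mem_leftWalks hP
  have hb : (0 : ℤ) ≤ (if c then 1 else 0) ∧ (if c then 1 else 0 : ℤ) ≤ 1 := by
    cases c <;> simp
  generalize (if c then (1 : ℤ) else 0) = b at hb ⊢
  generalize exitHt P = K at hPeq hKle ⊢
  rw [hPeq] at hW ⊢
  have hshape : wOut :: (l ++ [((-(L : ℤ) - 1, (K : ℤ), true) : HV)]) ++
      [((-(L : ℤ) - 1, (K : ℤ) + b, false) : HV), (-(L : ℤ) - 2, (K : ℤ) + b, true)] =
      wOut :: ((l ++ [(-(L : ℤ) - 1, (K : ℤ), true), (-(L : ℤ) - 1, (K : ℤ) + b, false)]) ++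
        [(-(L : ℤ) - 2, (K : ℤ) + b, true)]) := by
    simp
  rw [hshape]
  exact triDlStep_ext_mem_leftWalks hl hKle hb hW

/-- The two-step extension visits two more vertices: `ℓ = ℓ(P) + 2`.
[cite: GlazmanManolescu2019, §4.1 (T_L)] -/
theorem triDlStep_mwLen_ext {L : ℕ} {P : List HV} (c : Bool) (hP : P ∈ leftWalks L) :
    mwLen (P ++ [((-(L : ℤ) - 1, (exitHt P : ℤ) + (if c then 1 else 0), false) : HV),
      (-(L : ℤ) - 2, (exitHt P : ℤ) + (if c then 1 else 0), true)]) = mwLen P + 2 := by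
  obtain ⟨-, -, -, -, hW, -⟩ := mem_leftWalks hP
  obtain ⟨Q, rfl⟩ := hW.exists_eq_cons
  simp only [mwLen, List.cons_append, List.length_cons, List.length_append, List.length_nil]
  omega

/-- **Unit-step lower regularity of the triangle tail**: `(2 - √2) · triDl L ≤ triDl (L+1)` for
every `L` — the two-step extensions into the fresh column `x₀ = -L-1` inject
`leftWalks L × Bool` into `leftWalks (L+1)` at weight cost `x_c²` each, and `2 x_c² = 2 - √2`.
[cite: GlazmanManolescu2019, §4.1 (T_L)] -/
theorem stub_triDlStep : ∀ L : ℕ,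
    (2 - Real.sqrt 2) * Literature.Probability.RandomPlanarGeometry.SAW.HV.triDl L ≤
      Literature.Probability.RandomPlanarGeometry.SAW.HV.triDl (L + 1) := by
  intro L
  have h0 : 0 ≤ hexCriticalFugacity := hexCriticalFugacity_pos_lt_one.1.le
  -- reindex along the injection `(P, c) ↦ P ++ [u', u'']`
  have key :
      ∑ q ∈ leftWalks L ×ˢ (univ : Finset Bool), hexCriticalFugacity ^ mwLen (q.1 ++
          [((-(L : ℤ) - 1, (exitHt q.1 : ℤ) + (if q.2 then 1 else 0), false) : HV),
            (-(L : ℤ) - 2, (exitHt q.1 : ℤ) + (if q.2 then 1 else 0), true)]) ≤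
        ∑ Q ∈ leftWalks (L + 1), hexCriticalFugacity ^ mwLen Q := by
    refine sum_le_sum_of_injOn_of_nonneg _ (triDlStep_ext_injective L).injOn
      (fun q hq => ?_) (fun Q => hexCriticalFugacity ^ mwLen Q) (fun _ _ => pow_nonneg h0 _)
    obtain ⟨P, c⟩ := q
    exact triDlStep_ext_mem c (Finset.mem_product.1 hq).1
  -- the reindexed sum is `2 x_c² · triDl L`
  have hsum :
      ∑ q ∈ leftWalks L ×ˢ (univ : Finset Bool), hexCriticalFugacity ^ mwLen (q.1 ++
          [((-(L : ℤ) - 1, (exitHt q.1 : ℤ) + (if q.2 then 1 else 0), false) : HV),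
            (-(L : ℤ) - 2, (exitHt q.1 : ℤ) + (if q.2 then 1 else 0), true)]) =
        2 * hexCriticalFugacity ^ 2 * triDl L := by
    rw [triDl_eq, Finset.mul_sum, Finset.sum_product]
    refine Finset.sum_congr rfl fun P hP => ?_
    dsimp only
    rw [Fintype.sum_bool, triDlStep_mwLen_ext true hP, triDlStep_mwLen_ext false hP, pow_add]
    ring
  calc (2 - Real.sqrt 2) * triDl L = 2 * hexCriticalFugacity ^ 2 * triDl L := by
        rw [triDlStep_two_mul_hexCriticalFugacity_sq]
    _ = _ := hsum.symm
    _ ≤ ∑ Q ∈ leftWalks (L + 1), hexCriticalFugacity ^ mwLen Q := key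
    _ = triDl (L + 1) := (triDl_eq (L + 1)).symm

end Summit.CriticalPhenomena.SAWScalingLimit.Theorems.HexConjecture.RootLocality
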